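import Summits.QuantumFields.QCD.Theses.SpectralDefectExtinction
import Literature.MathematicalPhysics.QuantumFieldTheory.QCDPhaseQuenched
import Literature.MathematicalPhysics.QuantumFieldTheory.SpectralDefectDensity
import Literature.Barriers.QuantumFields.WilsonDeterminantMassSplitting

/-!
# Stub `schurComplement` of line `Sketch` (skeleton "ResolventCell", exterior elimination) for crux
`SpectralDefectExtinction.WegnerEstimate` (item stmt-QuantumFields-8966)

Abstract Feshbach–Schur reduction at `z = iε`.  Let a predicate `p` split an index type `n` into a
"cell" `{i // p i}` and an "exterior" `{i // ¬ p i}`, let `B` (cell × exterior) and a Hermitian `D`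
(exterior × exterior) be given, and `ε > 0`.  The cell self-energy `S = B (D − iε)⁻¹ Bᴴ` is
dissipative (`i (Sᴴ − S)` is positive semidefinite, since `Im (x⋆ S x) = ε ‖(D − iε)⁻¹ Bᴴ x‖² ≥ 0`),
its row `i` (column `j`) vanishes when row `i` (row `j`) of `B` does, and for every Hermitian `M` on `n`
with exterior blocks `B`, `D` the cell block of `(M − iε)⁻¹` is `(M_cell − iε − S)⁻¹`
(`Matrix.invOf_fromBlocks₂₂_eq` after reindexing along `Equiv.sumCompl p`; the Schur complement
`M_cell − iε − S` is nonsingular because the imaginary part of its quadratic form is `≤ −ε ‖v‖²`).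
-/

noncomputable section

namespace Summit.QuantumFields.QCD.Cruxes.WegnerEstimate.ResolventCell

open MeasureTheory
open scoped Matrix BigOperators
open Literature.MathematicalPhysics.QuantumLattice Literature.MathematicalPhysics.QuantumFieldTheory
  Literature.Probability.LatticeModels
open Literature.Barriers.QuantumFields (isHermitian_gammaFive_mul_wilsonDirac)
open Matrix
open scoped ComplexOrder

/-- The quadratic form of `i (Sᴴ − S)` is twice the imaginary part of the quadratic form of `S`:
`x⋆ (i (Sᴴ − S)) x = 2 Im (x⋆ S x)`. -/
theorem schurComplement_quadForm_dissipator {m : Type*} [Fintype m] (S : Matrix m m ℂ) (x : m → ℂ) :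
    star x ⬝ᵥ (Complex.I • (Sᴴ - S)) *ᵥ x = ((2 * (star x ⬝ᵥ S *ᵥ x).im : ℝ) : ℂ) := by
  have hconj : star x ⬝ᵥ Sᴴ *ᵥ x = star (star x ⬝ᵥ S *ᵥ x) := by
    rw [star_dotProduct, star_mulVec, conjTranspose_conjTranspose, ← dotProduct_mulVec]
  rw [smul_mulVec, dotProduct_smul, sub_mulVec, dotProduct_sub, hconj, smul_eq_mul]
  apply Complex.ext
  · simp [two_mul]
  · simp

/-- `i (Sᴴ − S)` is positive semidefinite as soon as `Im (x⋆ S x) ≥ 0` for every vector `x`. -/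
theorem schurComplement_posSemidef_of_im_nonneg {m : Type*} [Fintype m] (S : Matrix m m ℂ)
    (h : ∀ x : m → ℂ, 0 ≤ (star x ⬝ᵥ S *ᵥ x).im) : (Complex.I • (Sᴴ - S)).PosSemidef := by
  refine PosSemidef.of_dotProduct_mulVec_nonneg ?_ fun x => ?_
  · have hI : star Complex.I = -Complex.I := by
      apply Complex.ext <;> simp
    change (Complex.I • (Sᴴ - S))ᴴ = Complex.I • (Sᴴ - S)
    rw [conjTranspose_smul, conjTranspose_sub, conjTranspose_conjTranspose, hI, neg_smul, ← smul_neg,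
      neg_sub]
  · rw [schurComplement_quadForm_dissipator]
    exact Complex.zero_le_real.mpr (mul_nonneg zero_le_two (h x))

/-- **Nonsingularity from a dissipative gap.**  If `A` is Hermitian, `Im (x⋆ S x) ≥ 0` for all `x` and
`ε > 0`, then `A − iε − S` has nonzero determinant: a kernel vector `v` would give
`0 = Im (v⋆ (A − iε − S) v) = −ε ‖v‖² − Im (v⋆ S v) ≤ −ε ‖v‖²`. -/
theorem schurComplement_det_ne_zero {m : Type*} [Fintype m] [DecidableEq m] {A S : Matrix m m ℂ}
    (hA : A.IsHermitian) (hS : ∀ x : m → ℂ, 0 ≤ (star x ⬝ᵥ S *ᵥ x).im) {ε : ℝ} (hε : 0 < ε) :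
    (A - ((ε : ℂ) * Complex.I) • (1 : Matrix m m ℂ) - S).det ≠ 0 := by
  intro hdet
  obtain ⟨v, hv0, hv⟩ := Matrix.exists_mulVec_eq_zero_iff.mpr hdet
  have hq : star v ⬝ᵥ (A - ((ε : ℂ) * Complex.I) • (1 : Matrix m m ℂ) - S) *ᵥ v = 0 := by
    rw [hv, dotProduct_zero]
  rw [sub_mulVec, sub_mulVec, dotProduct_sub, dotProduct_sub, smul_mulVec, one_mulVec,
    dotProduct_smul, smul_eq_mul] at hq
  have him := congrArg Complex.im hq
  have hA0 : (star v ⬝ᵥ A *ᵥ v).im = 0 := by simpa using hA.im_star_dotProduct_mulVec_self v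
  have hs := Complex.nonneg_iff.mp (dotProduct_star_self_nonneg v)
  simp only [Complex.sub_im, hA0, Complex.mul_im, Complex.mul_re, Complex.ofReal_re,
    Complex.ofReal_im, Complex.I_re, Complex.I_im, mul_zero, mul_one, zero_mul, sub_zero, add_zero,
    zero_sub, zero_add, Complex.zero_im] at him
  have hre : (star v ⬝ᵥ v).re = 0 := by nlinarith [hS v, hs.1, mul_nonneg hε.le hs.1]
  have h0 : star v ⬝ᵥ v = 0 := Complex.ext (by simpa using hre) (by simpa using hs.2.symm)
  exact hv0 (dotProduct_star_self_eq_zero.mp h0)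

/-- For a Hermitian `D` and `ε > 0`, the exterior resolvent denominator `D − iε` is nonsingular. -/
theorem schurComplement_exterior_det_ne_zero {k : Type*} [Fintype k] [DecidableEq k]
    {D : Matrix k k ℂ} (hD : D.IsHermitian) {ε : ℝ} (hε : 0 < ε) :
    (D - ((ε : ℂ) * Complex.I) • (1 : Matrix k k ℂ)).det ≠ 0 := by
  simpa using schurComplement_det_ne_zero (S := 0) hD (fun x => by simp) hε

/-- **Dissipativity of the self-energy.**  For a Hermitian `D`, `ε > 0` and any `B`, the self-energy
`S = B (D − iε)⁻¹ Bᴴ` satisfies `Im (x⋆ S x) = ε ‖u‖² ≥ 0` with `u = (D − iε)⁻¹ Bᴴ x`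
(`x⋆ S x = (Bᴴx)⋆ u = (N u)⋆ u = u⋆ Nᴴ u = u⋆ D u + iε ‖u‖²`, `N = D − iε`). -/
theorem schurComplement_selfEnergy_im_nonneg {m k : Type*} [Fintype m] [Fintype k] [DecidableEq k]
    (B : Matrix m k ℂ) {D : Matrix k k ℂ} (hD : D.IsHermitian) {ε : ℝ} (hε : 0 < ε) (x : m → ℂ) :
    0 ≤ (star x ⬝ᵥ (B * (D - ((ε : ℂ) * Complex.I) • (1 : Matrix k k ℂ))⁻¹ * Bᴴ) *ᵥ x).im := by
  set N : Matrix k k ℂ := D - ((ε : ℂ) * Complex.I) • (1 : Matrix k k ℂ) with hN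
  have hdet : IsUnit N.det := isUnit_iff_ne_zero.mpr (schurComplement_exterior_det_ne_zero hD hε)
  set u : k → ℂ := N⁻¹ *ᵥ (Bᴴ *ᵥ x) with hu
  have hNu : N *ᵥ u = Bᴴ *ᵥ x := by
    rw [hu, mulVec_mulVec, mul_nonsing_inv _ hdet, one_mulVec]
  have hstar : star ((ε : ℂ) * Complex.I) = -((ε : ℂ) * Complex.I) := by
    apply Complex.ext <;> simp
  have hNH : Nᴴ = D + ((ε : ℂ) * Complex.I) • (1 : Matrix k k ℂ) := by
    rw [hN, conjTranspose_sub, conjTranspose_smul, conjTranspose_one, hD.eq, hstar, neg_smul,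
      sub_neg_eq_add]
  have key : star x ⬝ᵥ (B * N⁻¹ * Bᴴ) *ᵥ x =
      star u ⬝ᵥ D *ᵥ u + (ε : ℂ) * Complex.I * (star u ⬝ᵥ u) := by
    calc star x ⬝ᵥ (B * N⁻¹ * Bᴴ) *ᵥ x = star x ⬝ᵥ B *ᵥ u := by
          rw [← mulVec_mulVec, ← mulVec_mulVec]
      _ = star (N *ᵥ u) ⬝ᵥ u := by
          rw [hNu, dotProduct_mulVec, star_mulVec, conjTranspose_conjTranspose]
      _ = star u ⬝ᵥ Nᴴ *ᵥ u := by rw [star_mulVec, ← dotProduct_mulVec]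
      _ = star u ⬝ᵥ D *ᵥ u + (ε : ℂ) * Complex.I * (star u ⬝ᵥ u) := by
          rw [hNH, add_mulVec, dotProduct_add, smul_mulVec, one_mulVec, dotProduct_smul, smul_eq_mul]
  have hD0 : (star u ⬝ᵥ D *ᵥ u).im = 0 := by simpa using hD.im_star_dotProduct_mulVec_self u
  have hs : 0 ≤ (star u ⬝ᵥ u).re := (Complex.nonneg_iff.mp (dotProduct_star_self_nonneg u)).1
  rw [key, Complex.add_im, hD0, Complex.mul_im]
  simp only [Complex.mul_re, Complex.mul_im, Complex.ofReal_re, Complex.ofReal_im, Complex.I_re,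
    Complex.I_im, mul_zero, mul_one, zero_mul, sub_zero, add_zero, zero_add]
  exact mul_nonneg hε.le hs

/-- **Feshbach–Schur block formula at `z = iε`.**  For a Hermitian `M` on `n` whose cell × exterior block
is `B` and whose exterior block is the Hermitian `D`, the cell block of `(M − iε)⁻¹` is the inverse of the
dressed cell block `M_cell − iε − B (D − iε)⁻¹ Bᴴ` (reindex along `Equiv.sumCompl p`, then
`Matrix.invOf_fromBlocks₂₂_eq`). -/
theorem schurComplement_block {n : Type} [Fintype n] [DecidableEq n] (p : n → Prop) [DecidablePred p]
    {ε : ℝ} (hε : 0 < ε) {B : Matrix {i // p i} {i // ¬ p i} ℂ} {D : Matrix {i // ¬ p i} {i // ¬ p i} ℂ}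
    (hD : D.IsHermitian) {M : Matrix n n ℂ} (hM : M.IsHermitian)
    (hMB : ∀ (i : {i // p i}) (k : {i // ¬ p i}), M i.1 k.1 = B i k)
    (hMD : ∀ (k l : {i // ¬ p i}), M k.1 l.1 = D k l) (i j : {i // p i}) :
    ((M - ((ε : ℂ) * Complex.I) • (1 : Matrix n n ℂ))⁻¹ : Matrix n n ℂ) i.1 j.1 =
      ((M.submatrix Subtype.val Subtype.val - ((ε : ℂ) * Complex.I) • (1 : Matrix {i // p i} {i // p i} ℂ) -
          B * (D - ((ε : ℂ) * Complex.I) • (1 : Matrix {i // ¬ p i} {i // ¬ p i} ℂ))⁻¹ * Bᴴ)⁻¹ :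
        Matrix {i // p i} {i // p i} ℂ) i j := by
  have hS := schurComplement_selfEnergy_im_nonneg B hD hε
  set c : ℂ := (ε : ℂ) * Complex.I with hc
  set A' : Matrix {i // p i} {i // p i} ℂ := M.submatrix Subtype.val Subtype.val - c • 1 with hA'
  set D' : Matrix {i // ¬ p i} {i // ¬ p i} ℂ := D - c • 1 with hD'
  set e := Equiv.sumCompl p with he
  -- the block decomposition of `M - iε` along `e`
  have hblock : (M - c • (1 : Matrix n n ℂ)).submatrix e e = fromBlocks A' B Bᴴ D' := by
    ext (i | k) (j | l)
    · simp [hA', he, one_apply, Subtype.val_inj]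
    · have hne : (i : n) ≠ l := fun h => l.2 (h ▸ i.2)
      simp [he, one_apply, hMB, hne]
    · have hne : (k : n) ≠ j := fun h => k.2 (h ▸ j.2)
      have hkj : M k.1 j.1 = star (B j k) := by rw [← hMB, hM.apply]
      simp [he, one_apply, hne, hkj, conjTranspose_apply]
    · simp [hD', he, one_apply, hMD, Subtype.val_inj]
  -- invertibility of the exterior block and of the Schur complement
  have hD'det : IsUnit D'.det := isUnit_iff_ne_zero.mpr (schurComplement_exterior_det_ne_zero hD hε)
  letI invD' : Invertible D' := invertibleOfIsUnitDet D' hD'det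
  have hT : A' - B * ⅟D' * Bᴴ = A' - B * D'⁻¹ * Bᴴ := by rw [invOf_eq_nonsing_inv]
  have hTdet : IsUnit (A' - B * ⅟D' * Bᴴ).det := by
    rw [hT, hA']
    exact isUnit_iff_ne_zero.mpr (schurComplement_det_ne_zero (hM.submatrix Subtype.val) hS hε)
  letI invT : Invertible (A' - B * ⅟D' * Bᴴ) := invertibleOfIsUnitDet _ hTdet
  letI invBlk : Invertible (fromBlocks A' B Bᴴ D') := fromBlocks₂₂Invertible A' B Bᴴ D'
  calc (M - c • (1 : Matrix n n ℂ))⁻¹ i.1 j.1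
      = ((M - c • (1 : Matrix n n ℂ))⁻¹.submatrix e e) (Sum.inl i) (Sum.inl j) := by simp [he]
    _ = ((M - c • (1 : Matrix n n ℂ)).submatrix e e)⁻¹ (Sum.inl i) (Sum.inl j) := by
        rw [inv_submatrix_equiv]
    _ = (⅟(fromBlocks A' B Bᴴ D')) (Sum.inl i) (Sum.inl j) := by rw [hblock, invOf_eq_nonsing_inv]
    _ = (⅟(A' - B * ⅟D' * Bᴴ)) i j := by rw [invOf_fromBlocks₂₂_eq, fromBlocks_apply₁₁]
    _ = (A' - B * D'⁻¹ * Bᴴ)⁻¹ i j := by simp only [invOf_eq_nonsing_inv]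

/-- **Stub `schurComplement` (abstract Feshbach–Schur reduction at `z = iε`).**  Let `p` split the index type
`n` into a "cell" `{i // p i}` and an "exterior" `{i // ¬ p i}`, and let `B` (cell × exterior) and `D` (exterior ×
exterior, Hermitian) be given, `ε > 0`.  Then there is a cell self-energy `S` — namely `S = B (D − iε)⁻¹ Bᴴ` —
which is DISSIPATIVE (`i (Sᴴ − S)` positive semidefinite, i.e. `Im S = ε B |D − iε|⁻² Bᴴ ≥ 0`), whose row `i`
(column `j`) vanishes whenever row `i` (row `j`) of `B` vanishes, and such that for EVERY Hermitian `M` on `n`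
with exterior blocks `B` and `D`, the cell block of the resolvent `(M − iε)⁻¹` equals `(M_cell − iε − S)⁻¹`
entrywise.  (Mathlib: `Equiv.sumCompl p`, `invOf_fromBlocks₂₂_eq`, `inv_submatrix_equiv`; the Schur complement
`M_cell − iε − S` is invertible because its imaginary part is `≤ −ε`.) -/
theorem stub_schurComplement {n : Type} [Fintype n] [DecidableEq n] (p : n → Prop) [DecidablePred p]
    (ε : ℝ) (hε : 0 < ε) (B : Matrix {i // p i} {i // ¬ p i} ℂ) (D : Matrix {i // ¬ p i} {i // ¬ p i} ℂ)
    (hD : D.IsHermitian) :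
    ∃ S : Matrix {i // p i} {i // p i} ℂ,
      (Complex.I • (Sᴴ - S)).PosSemidef ∧
      (∀ i j : {i // p i}, (∀ k, B i k = 0) → S i j = 0) ∧
      (∀ i j : {i // p i}, (∀ k, B j k = 0) → S i j = 0) ∧
      ∀ M : Matrix n n ℂ, M.IsHermitian →
        (∀ (i : {i // p i}) (k : {i // ¬ p i}), M i.1 k.1 = B i k) →
        (∀ (k l : {i // ¬ p i}), M k.1 l.1 = D k l) →
        ∀ i j : {i // p i},
          ((M - ((ε : ℂ) * Complex.I) • (1 : Matrix n n ℂ))⁻¹ : Matrix n n ℂ) i.1 j.1 =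
            ((M.submatrix Subtype.val Subtype.val -
                ((ε : ℂ) * Complex.I) • (1 : Matrix {i // p i} {i // p i} ℂ) - S)⁻¹ :
              Matrix {i // p i} {i // p i} ℂ) i j := by
  refine ⟨B * (D - ((ε : ℂ) * Complex.I) • (1 : Matrix {i // ¬ p i} {i // ¬ p i} ℂ))⁻¹ * Bᴴ,
    schurComplement_posSemidef_of_im_nonneg _ (schurComplement_selfEnergy_im_nonneg B hD hε),
    fun i j h => ?_, fun i j h => ?_,
    fun M hM hMB hMD i j => schurComplement_block p hε hD hM hMB hMD i j⟩
  · simp [mul_apply, h]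
  · simp [mul_apply, h]

end Summit.QuantumFields.QCD.Cruxes.WegnerEstimate.ResolventCell

end
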